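import Literature.AlgebraicGeometry.Modules.CechComplexExactOfFibrewiseExactPoints
import HarnessLib

/-!
# Exact ⇒ exact after EVERY base change ⇒ exact on every fibre: the converse (E2) of «fibrewise exact ⇒ exact» for the flat Čech
# complex of a vector bundle on a proper flat family (Mumford AV §5 Cor. 3, the «if» direction; Hartshorne III 12.11)

Topic `AlgebraicGeometry/Modules`; namespace `Literature.AlgebraicGeometry.Modules` (§1 pure algebra in `Literature.Algebra.Homology`).  THEOREMS
ONLY (no definition, no named fact, no instance, no notation, no `sorry`); books 0.

Cell hodgecm-mathlib (D-0151), P6 «MOD programme», DUAL-S road (A), **brick (CBC-1), second sequel = B-p08 (g33)'s ADDENDUM (E2)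
2026-09-02T00:11Z** «EXACT ⇒ FIBREWISE EXACT» (needed by CBC-4 Step 2 at the single point `1 ∈ V_{j₀}`: read `Ȟ⁰(A, 𝒪_A) = 0` off an acyclic
column).  B-p04 (g40).  HC_CM is proved only modulo the printed citations (2 remaining named inputs hLiu418 24832, h413 24833) until rung 0
closes; count-neutral capital.

THE MATHEMATICS.  A bounded-above complex `P•` of finite projective modules that is EXACT in degrees `≥ q` is SPLIT there (descending from the
top: `d^{r−1}` maps onto the projective `P^r`, its kernel is a finite projective direct summand, and so on — ★ `ker_baseChange_of_surjective`,
no Nakayama and no locality needed), hence `P• ⊗ B` is exact in degrees `≥ q` for every `R`-algebra `B`.  Across a strictly perfect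
witness `ψ : P• ⥲ C•` (★ `function_exact_baseChange_iff_of_quasiIso`, Mumford §5 Lemma 2) the same holds for the flat Čech complex `C•`; reading
`B' := Γ(Spec K, 𝒪)` through ★ affine base change gives the fibres (★ (E1″) `cechComplex_fibre_exactAt_of_forall_exact_baseChange`).
* §1 `kerBaseChange_step_of_exact` (★ `kerBaseChange_step` with the residue-field∕Nakayama input replaced by exactness over `R`),
  **`exact_baseChange_of_exact_of_finite_projective`** (strictly perfect, exact in degrees `≥ q` over `R` ⇒ exact after every base change),
  **`exact_baseChange_of_quasiIso_of_exact`** (the same on the flat complex `C•` through `ψ : P• ⥲ C•`).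
* §2 **`cechComplex_exact_baseChange_of_exactAt`** — (E2) for `Č•(𝓤, G)` of a finite locally free `G` on a proper flat `g : X → B`, `B` affine
  locally noetherian: `(∀ i ≥ q, Č•.ExactAt i) ⇒ ∀ B', ∀ i ≥ q, Function.Exact (dⁱ⁻¹ ⊗ B') (dⁱ ⊗ B')`; **`cechComplex_fibre_exactAt_of_exactAt`** —
  ⇒ every fibre Čech complex (B-p08's (S2) currency, ANY field-valued point `b : Spec K → B`) is exact in every degree `i ≥ q`; and the same for ANY
  cartesian presentation `H : IsPullback kX g' g b` of the fibre (`cechComplex_exactAt_of_isPullback_of_forall_exact_baseChange`,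
  `cechComplex_exactAt_of_isPullback_of_exactAt` — the SLICE maps of CBC-3 are such presentations, no comparison with `pullback g b` needed).
* §3 the (E1′) INPUT side with any presentation per `k`-point: `cechComplex_exactAt_iff_of_isPullback_of_isPullback` (two presentations of one
  fibre are simultaneously exact), `cechComplex_exact_baseChange_of_forall_kPoint_isPullback`, `cechComplex_exactAt_of_forall_kPoint_isPullback`,
  `cechComplex_exactAt_of_isPullback_of_forall_kPoint_isPullback`.

## References
* [MumfordAV1970] D. Mumford, *Abelian Varieties* (1970), §5 Lemma 1 (p. 47), Lemma 2 (p. 49), Cor. 2 (p. 50), Cor. 3 (p. 53).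
* [Hartshorne1977] R. Hartshorne, *Algebraic Geometry* (1977), III Thm. 12.11 (p. 290), III Lemma 12.3.
* [EGAIII2] A. Grothendieck, J. Dieudonné, EGA III₂ (1963), 7.7.5, 7.7.10.
* Tree: ★ `Algebra/Module/KernelBaseChangeDescent` (`ker_baseChange_of_surjective`, `range_le_ker_of_comp_eq_zero`, `baseChange_comp_baseChange_eq_zero`),
  ★ `Algebra/Module/SplitSurjectiveBaseChange` (`surjective_baseChange_of_surjective`), ★ `StrictlyPerfectVanishingBaseChange` (`ker_top_baseChange`,
  `exact_baseChange_of_subsingleton`, `hom_d_comp_hom_d`), ★ `VanishingBaseChangeOfQuasiIso`, ★ `GrothendieckComplexOfProper`, ★ (E1″).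
-/

set_option autoImplicit false

open CategoryTheory CategoryTheory.Limits AlgebraicGeometry TensorProduct Module
open Literature.Algebra.Homology Literature.Algebra.Module

noncomputable section

universe u

/-! ### §1 Algebra: a strictly perfect complex exact above `q` stays exact after every base change -/

namespace Literature.Algebra.Homology

section Step

variable {R : Type u} [CommRing R] {P Q W : Type u} [AddCommGroup P] [Module R P] [AddCommGroup Q] [Module R Q]
  [AddCommGroup W] [Module R W] (d : P →ₗ[R] Q) (e : Q →ₗ[R] W) (hde : e ∘ₗ d = 0)

include hde in
/-- **THE STEP, from exactness over `R`** (★ `kerBaseChange_step` with Nakayama replaced by the hypothesis `Function.Exact d e`): `P` finite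
projective, `ker e` finite projective commuting with base change, `P → Q → W` exact ⇒ `ker d` finite projective commuting with base change and
`P ⊗ B → Q ⊗ B → W ⊗ B` exact for every `R`-algebra `B`. [cite: MumfordAV1970, §5 Cor. 2 (p. 50) and Cor. 3 (p. 53)] -/
theorem kerBaseChange_step_of_exact [Module.Finite R P] [Module.Projective R P]
    (hZ : Module.Finite R (LinearMap.ker e) ∧ Module.Projective R (LinearMap.ker e))
    (hZbc : ∀ (B : Type u) [CommRing B] [Algebra R B],
      Function.Injective ((LinearMap.ker e).subtype.baseChange B) ∧
        LinearMap.range ((LinearMap.ker e).subtype.baseChange B) = LinearMap.ker (e.baseChange B))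
    (hex : Function.Exact d e) :
    (Module.Finite R (LinearMap.ker d) ∧ Module.Projective R (LinearMap.ker d)) ∧
      (∀ (B : Type u) [CommRing B] [Algebra R B],
        Function.Injective ((LinearMap.ker d).subtype.baseChange B) ∧
          LinearMap.range ((LinearMap.ker d).subtype.baseChange B) = LinearMap.ker (d.baseChange B)) ∧
      ∀ (B : Type u) [CommRing B] [Algebra R B], Function.Exact (d.baseChange B) (e.baseChange B) := by
  haveI := hZ.1
  haveI := hZ.2
  -- the corestriction `δ : P → Z := ker e`, onto by exactness over `R`
  set δ := d.codRestrict (LinearMap.ker e) fun x => range_le_ker_of_comp_eq_zero d e hde ⟨x, rfl⟩ with hδ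
  have hsub : (LinearMap.ker e).subtype ∘ₗ δ = d := LinearMap.ext fun x => rfl
  have hδsurj : Function.Surjective δ := by
    intro z
    obtain ⟨x, hx⟩ := (hex z.1).1 z.2
    exact ⟨x, Subtype.ext hx⟩
  have hker : LinearMap.ker δ = LinearMap.ker d := by
    ext x
    simp only [LinearMap.mem_ker, hδ]
    exact ⟨fun h => congrArg Subtype.val h, fun h => Subtype.ext h⟩
  obtain ⟨⟨hfin, hproj⟩, hbc⟩ := ker_baseChange_of_surjective δ hδsurj
  refine ⟨⟨hker ▸ hfin, hker ▸ hproj⟩, fun B _ _ => ?_, fun B _ _ => ?_⟩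
  · obtain ⟨hinjZ, hranZ⟩ := hZbc B
    obtain ⟨hinjδ, hranδ⟩ := hbc B
    have hι : (LinearMap.ker d).subtype = (LinearMap.ker δ).subtype ∘ₗ (LinearEquiv.ofEq _ _ hker.symm).toLinearMap :=
      LinearMap.ext fun x => rfl
    have hι' : (LinearMap.ker d).subtype.baseChange B =
        (LinearMap.ker δ).subtype.baseChange B ∘ₗ ((LinearEquiv.ofEq _ _ hker.symm).toLinearMap.baseChange B) := by
      rw [hι, LinearMap.baseChange_comp]
    have hequiv : Function.Bijective ((LinearEquiv.ofEq _ _ hker.symm).toLinearMap.baseChange B :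
        B ⊗[R] LinearMap.ker d → B ⊗[R] LinearMap.ker δ) :=
      ((LinearEquiv.ofEq (LinearMap.ker d) (LinearMap.ker δ) hker.symm).baseChange R B _ _).bijective
    refine ⟨?_, ?_⟩
    · rw [hι', LinearMap.coe_comp]
      exact hinjδ.comp hequiv.1
    · rw [hι', LinearMap.range_comp, LinearMap.range_eq_top.2 hequiv.2, Submodule.map_top, hranδ]
      ext x
      rw [LinearMap.mem_ker, LinearMap.mem_ker, ← hsub, LinearMap.baseChange_comp, LinearMap.comp_apply]
      exact ⟨fun h => by rw [h, map_zero], fun h => hinjZ (by rw [h, map_zero])⟩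
  · obtain ⟨-, hranZ⟩ := hZbc B
    apply LinearMap.exact_of_comp_eq_zero_of_ker_le_range (baseChange_comp_baseChange_eq_zero d e hde B)
    intro y hy
    rw [← hranZ] at hy
    obtain ⟨z, rfl⟩ := hy
    obtain ⟨x, rfl⟩ := surjective_baseChange_of_surjective δ hδsurj B z
    exact ⟨x, by rw [← LinearMap.comp_apply, ← LinearMap.baseChange_comp, hsub]⟩

end Step

section Complex

variable {R : Type u} [CommRing R] (K : CochainComplex (ModuleCat.{u} R) ℤ)

/-- **A STRICTLY PERFECT COMPLEX EXACT IN DEGREES `≥ q` STAYS EXACT THERE AFTER EVERY BASE CHANGE** (no locality, no Nakayama: it is split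
exact above `q`): `K•` with finite projective terms, `Kⁱ = 0` for `i > r`, `Function.Exact d^{i−1} dⁱ` for all `i ≥ q` ⇒ for every `R`-algebra
`B` and every `i ≥ q`, `Function.Exact (d^{i−1} ⊗ B) (dⁱ ⊗ B)` — and `Z^{q−1}` is finite projective commuting with base change.
[cite: MumfordAV1970, §5 Cor. 3 (p. 53)] [cite: Hartshorne1977, III Lemma 12.3 and Thm. 12.11 (p. 290)] -/
theorem exact_baseChange_of_exact_of_finite_projective (r : ℤ) (htop : ∀ i, r < i → Subsingleton (K.X i))
    (hK : ∀ n, Module.Finite R (K.X n) ∧ Module.Projective R (K.X n)) (q : ℤ)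
    (hexR : ∀ i, q ≤ i → Function.Exact (K.d (i - 1) i).hom (K.d i (i + 1)).hom) :
    (∀ (B : Type u) [CommRing B] [Algebra R B] (i : ℤ), q ≤ i →
        Function.Exact ((K.d (i - 1) i).hom.baseChange B) ((K.d i (i + 1)).hom.baseChange B)) ∧
      (Module.Finite R (LinearMap.ker (K.d (q - 1) q).hom) ∧ Module.Projective R (LinearMap.ker (K.d (q - 1) q).hom)) ∧
      ∀ (B : Type u) [CommRing B] [Algebra R B],
        Function.Injective ((LinearMap.ker (K.d (q - 1) q).hom).subtype.baseChange B) ∧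
          LinearMap.range ((LinearMap.ker (K.d (q - 1) q).hom).subtype.baseChange B) =
            LinearMap.ker ((K.d (q - 1) q).hom.baseChange B) := by
  have INV : ∀ n : ℕ, ∀ m : ℤ, m = r - n → q - 1 ≤ m →
      ((Module.Finite R (LinearMap.ker (K.d m (m + 1)).hom) ∧ Module.Projective R (LinearMap.ker (K.d m (m + 1)).hom)) ∧
        ∀ (B : Type u) [CommRing B] [Algebra R B],
          Function.Injective ((LinearMap.ker (K.d m (m + 1)).hom).subtype.baseChange B) ∧
            LinearMap.range ((LinearMap.ker (K.d m (m + 1)).hom).subtype.baseChange B) =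
              LinearMap.ker ((K.d m (m + 1)).hom.baseChange B)) ∧
      ∀ (B : Type u) [CommRing B] [Algebra R B] (i : ℤ), m < i → q ≤ i →
        Function.Exact ((K.d (i - 1) i).hom.baseChange B) ((K.d i (i + 1)).hom.baseChange B) := by
    intro n
    induction n with
    | zero =>
      intro m hm _
      haveI : Subsingleton (K.X (m + 1)) := htop _ (by omega)
      refine ⟨ker_top_baseChange K m (hK m), fun B _ _ i hi _ => ?_⟩
      haveI : Subsingleton (K.X i) := htop _ (by omega)
      exact exact_baseChange_of_subsingleton K i B
    | succ n ih =>
      intro m hm hqm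
      obtain ⟨⟨hZ, hZbc⟩, hexact⟩ := ih (m + 1) (by omega) (by omega)
      haveI := (hK m).1
      haveI := (hK m).2
      have hm1 : q ≤ m + 1 := by omega
      have hstep := kerBaseChange_step_of_exact (K.d m (m + 1)).hom (K.d (m + 1) (m + 1 + 1)).hom (hom_d_comp_hom_d K _ _ _) hZ
        (fun B _ _ => hZbc B) (by
          have h := hexR (m + 1) hm1
          rwa [show m + 1 - 1 = m by omega] at h)
      obtain ⟨hZ', hZbc', hex'⟩ := hstep
      refine ⟨⟨hZ', fun B _ _ => hZbc' B⟩, fun B _ _ i hi hqi => ?_⟩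
      by_cases him : i = m + 1
      · subst him
        rw [show m + 1 - 1 = m by omega]
        exact hex' B
      · exact hexact B i (by omega) hqi
  have hq : q - 1 + 1 = q := by omega
  by_cases hqr : q - 1 ≤ r
  · obtain ⟨n, hn⟩ : ∃ n : ℕ, (q - 1 : ℤ) = r - n := ⟨(r - (q - 1)).toNat, by omega⟩
    obtain ⟨hinv, hexact⟩ := INV n (q - 1) hn le_rfl
    rw [hq] at hinv
    exact ⟨fun B _ _ i hqi => hexact B i (by omega) hqi, hinv.1, fun B _ _ => hinv.2 B⟩
  · haveI : Subsingleton (K.X (q - 1 + 1)) := htop _ (by omega)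
    have htop' := ker_top_baseChange K (q - 1) (hK (q - 1))
    rw [hq] at htop'
    refine ⟨fun B _ _ i hqi => ?_, htop'.1, fun B _ _ => htop'.2 B⟩
    haveI : Subsingleton (K.X i) := htop _ (by omega)
    exact exact_baseChange_of_subsingleton K i B

/-- `IsStrictlyLE` form of the previous theorem (the output shape of ★ `exists_strictlyPerfect_quasiIso_cechComplex_of_isProper`), exactness half.
[cite: MumfordAV1970, §5 Cor. 3 (p. 53)] -/
theorem exact_baseChange_of_exact_of_isStrictlyLE (r : ℤ) [K.IsStrictlyLE r]
    (hK : ∀ n, Module.Finite R (K.X n) ∧ Module.Projective R (K.X n)) (q : ℤ)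
    (hexR : ∀ i, q ≤ i → Function.Exact (K.d (i - 1) i).hom (K.d i (i + 1)).hom)
    (B : Type u) [CommRing B] [Algebra R B] (i : ℤ) (hi : q ≤ i) :
    Function.Exact ((K.d (i - 1) i).hom.baseChange B) ((K.d i (i + 1)).hom.baseChange B) :=
  (exact_baseChange_of_exact_of_finite_projective K r
    (fun j hj => ModuleCat.subsingleton_of_isZero (K.isZero_of_isStrictlyLE r j hj)) hK q hexR).1 B i hi

variable {K} {C : CochainComplex (ModuleCat.{u} R) ℤ} (ψ : K ⟶ C)

/-- **ON THE FLAT COMPLEX through a strictly perfect witness `ψ : P• ⥲ C•`**: `C•` termwise flat, both zero above `r`, `C•` exact in degrees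
`≥ q` ⇒ `C• ⊗ B` exact in degrees `≥ q` for every `R`-algebra `B` (Mumford §5 Lemma 2 ★ `function_exact_baseChange_iff_of_quasiIso` twice, the
second time at `B := R` through ★ `function_exact_baseChange_self_iff`). [cite: MumfordAV1970, §5 Lemma 2 (p. 49) and Cor. 3 (p. 53)] -/
theorem exact_baseChange_of_quasiIso_of_exact [QuasiIso ψ] (r : ℤ) [K.IsStrictlyLE r] [C.IsStrictlyLE r]
    (hK : ∀ n, Module.Finite R (K.X n) ∧ Module.Projective R (K.X n)) (hC : ∀ n, Module.Flat R (C.X n)) (q : ℤ)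
    (hexC : ∀ i, q ≤ i → Function.Exact (C.d (i - 1) i).hom (C.d i (i + 1)).hom)
    (B : Type u) [CommRing B] [Algebra R B] (i : ℤ) (hi : q ≤ i) :
    Function.Exact ((C.d (i - 1) i).hom.baseChange B) ((C.d i (i + 1)).hom.baseChange B) := by
  have hKf := flat_X_of_finite_projective hK
  have hexK : ∀ j, q ≤ j → Function.Exact (K.d (j - 1) j).hom (K.d j (j + 1)).hom := fun j hj =>
    (Literature.AlgebraicGeometry.Modules.function_exact_baseChange_self_iff _ _).1
      ((function_exact_baseChange_iff_of_quasiIso ψ hKf hC r R j).2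
        ((Literature.AlgebraicGeometry.Modules.function_exact_baseChange_self_iff _ _).2 (hexC j hj)))
  exact (function_exact_baseChange_iff_of_quasiIso ψ hKf hC r B i).1
    (exact_baseChange_of_exact_of_isStrictlyLE K r hK q hexK B i hi)

end Complex

end Literature.Algebra.Homology

/-! ### §2 The Čech complex of a vector bundle on a proper flat family: exact ⇒ exact after base change ⇒ exact fibres -/

namespace Literature.AlgebraicGeometry.Modules

open Literature.AlgebraicGeometry.Morphisms Literature.AlgebraicGeometry.HodgeTheory Literature.AlgebraicGeometry.Motives

section E2

variable {X B : Scheme.{0}} (g : X ⟶ B) [IsAffine B] [IsProper g] [IsLocallyNoetherian B] [Flat g]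
  {ι : Type} [LinearOrder ι] [Fintype ι] (U : ι → X.Opens) (hcov : ⨆ i, U i = ⊤)
  (hUa : ∀ s : Finset ι, s.Nonempty → IsAffineOpen (cechOpen U s)) (G : X.Modules) (hL : IsFiniteLocallyFree G)

include hcov hUa hL in
/-- **(E2) EXACT ⇒ EXACT AFTER EVERY BASE CHANGE** for `C• = Č•(𝓤, G)` (`G` finite locally free on a proper flat `g : X → B`, `B` affine locally
noetherian, `𝓤` finite with affine finite intersections): `(∀ i ≥ q, C•.ExactAt i) ⇒ ∀ B', ∀ i ≥ q, Function.Exact (dⁱ⁻¹ ⊗ B') (dⁱ ⊗ B')`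
(★ Grothendieck complex + §1). [cite: MumfordAV1970, §5 Lemma 1 (p. 47), Cor. 3 (p. 53)] [cite: Hartshorne1977, III Thm. 12.11 (p. 290)] -/
theorem cechComplex_exact_baseChange_of_exactAt (q : ℤ)
    (hex : ∀ i, q ≤ i → (cechComplex U G g.appTop.hom).ExactAt i)
    (B' : Type) [CommRing B'] [Algebra Γ(B, ⊤) B'] (i : ℤ) (hi : q ≤ i) :
    Function.Exact (((cechComplex U G g.appTop.hom).d (i - 1) i).hom.baseChange B')
      (((cechComplex U G g.appTop.hom).d i (i + 1)).hom.baseChange B') := by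
  obtain ⟨K, ψ, hψ, -, hKle, hK⟩ := exists_strictlyPerfect_quasiIso_cechComplex_of_isProper g U hcov hUa G hL
    (Fintype.card ι) (by omega)
  haveI := hψ
  haveI := hKle
  haveI : (cechComplex U G g.appTop.hom).IsStrictlyLE ((Fintype.card ι : ℕ) : ℤ) := isStrictlyLE_cechComplex U G _ _ (by omega)
  have hflat := flat_cechComplex_X U G _ (flat_secMod_of_flat g U hUa G hL)
  have hexC : ∀ j, q ≤ j → Function.Exact ((cechComplex U G g.appTop.hom).d (j - 1) j).hom
      ((cechComplex U G g.appTop.hom).d j (j + 1)).hom := fun j hj =>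
    (exactAt_iff_function_exact (cechComplex U G g.appTop.hom) (j - 1) j (j + 1) (by omega) rfl).1 (hex j hj)
  exact exact_baseChange_of_quasiIso_of_exact ψ ((Fintype.card ι : ℕ) : ℤ) hK hflat q hexC B' i hi

include hcov hUa hL in
/-- **(E2) ⇒ FIBRES: EXACT ⇒ EXACT ON EVERY FIELD-VALUED FIBRE** (B-p08's (S2) currency): if `Č•(𝓤, G)` is exact in every degree `i ≥ q` then
for every field `K` and every `b : Spec K → B` the fibre Čech complex `Č•((pr_X⁻¹ U_j)_j, pr_X^* G)` of `pullback g b` is exact in every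
degree `i ≥ q` (§2 + ★ (E1″)). [cite: MumfordAV1970, §5 Cor. 3 (p. 53)] [cite: GortzWedhorn2023, Prop. 22.90 (p. 277)] -/
theorem cechComplex_fibre_exactAt_of_exactAt (q : ℤ)
    (hex : ∀ i, q ≤ i → (cechComplex U G g.appTop.hom).ExactAt i)
    {K : Type} [Field K] (b : Spec (.of K) ⟶ B) (i : ℤ) (hi : q ≤ i) :
    (cechComplex (fun j => (pullback.fst g b) ⁻¹ᵁ U j) ((Scheme.Modules.pullback (pullback.fst g b)).obj G)
      (pullback.snd g b).appTop.hom).ExactAt i :=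
  cechComplex_fibre_exactAt_of_forall_exact_baseChange g U hUa G hL q
    (fun B' _ _ j hj => cechComplex_exact_baseChange_of_exactAt g U hcov hUa G hL q hex B' j hj) b i hi

omit [IsProper g] [IsLocallyNoetherian B] [Flat g] in
include hUa hL in
/-- **(E1″), ANY PRESENTATION OF THE FIBRE**: if `Č•(𝓤, G) ⊗_{Γ(B)} B'` is exact in every degree `i ≥ q` for every `Γ(B)`-algebra `B'`, then for
every field-valued point `b : Spec K → B` and EVERY cartesian square `H : IsPullback kX g' g b` (`kX : X' → X`, `g' : X' → Spec K` — e.g. a slice map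
of a product, not necessarily Mathlib's chosen `pullback g b`) the Čech complex `Č•((kX⁻¹ U_j)_j, kX^* G)` of `X'` (scalars `g'♯`) is exact in every
degree `i ≥ q` (★ `exists_extendScalars_cechComplex_iso_of_isPullback` accepts any cartesian square). [cite: MumfordAV1970, §5 Cor. 3 (p. 53)]
[cite: GortzWedhorn2023, Prop. 22.90 (p. 277)] -/
theorem cechComplex_exactAt_of_isPullback_of_forall_exact_baseChange (q : ℤ)
    (hall : ∀ (B' : Type) [CommRing B'] [Algebra Γ(B, ⊤) B'], ∀ i, q ≤ i →
      Function.Exact (((cechComplex U G g.appTop.hom).d (i - 1) i).hom.baseChange B')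
        (((cechComplex U G g.appTop.hom).d i (i + 1)).hom.baseChange B'))
    {K : Type} [Field K] {b : Spec (.of K) ⟶ B} {X' : Scheme.{0}} {kX : X' ⟶ X} {g' : X' ⟶ Spec (.of K)}
    (H : IsPullback kX g' g b) (i : ℤ) (hi : q ≤ i) :
    (cechComplex (fun j => kX ⁻¹ᵁ U j) ((Scheme.Modules.pullback kX).obj G) g'.appTop.hom).ExactAt i := by
  have hGa : IsAffineLocalizing G := by
    haveI := hL.isVectorBundle.1
    exact IsAffineLocalizing.of_isQuasicoherent G
  letI algb := (b.appLE ⊤ ⊤ le_top).hom.toAlgebra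
  obtain ⟨Φ, -⟩ := exists_extendScalars_cechComplex_iso_of_isPullback H U hUa G hGa
  have hext : (((ModuleCat.extendScalars (b.appLE ⊤ ⊤ le_top).hom).mapHomologicalComplex (ComplexShape.up ℤ)).obj
      (cechComplex U G g.appTop.hom)).ExactAt i := by
    rw [exactAt_extendScalars_iff]
    exact hall _ i hi
  exact hext.of_iso Φ

include hcov hUa hL in
/-- **(E2) ⇒ FIBRES, ANY PRESENTATION**: `Č•(𝓤, G)` exact in every degree `i ≥ q` ⇒ for every field-valued point `b` and every cartesian square
`H : IsPullback kX g' g b` the Čech complex `Č•((kX⁻¹ U_j)_j, kX^* G)` (scalars `g'♯`) is exact in every degree `i ≥ q`.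
[cite: MumfordAV1970, §5 Cor. 3 (p. 53)] [cite: GortzWedhorn2023, Prop. 22.90 (p. 277)] -/
theorem cechComplex_exactAt_of_isPullback_of_exactAt (q : ℤ)
    (hex : ∀ i, q ≤ i → (cechComplex U G g.appTop.hom).ExactAt i)
    {K : Type} [Field K] {b : Spec (.of K) ⟶ B} {X' : Scheme.{0}} {kX : X' ⟶ X} {g' : X' ⟶ Spec (.of K)}
    (H : IsPullback kX g' g b) (i : ℤ) (hi : q ≤ i) :
    (cechComplex (fun j => kX ⁻¹ᵁ U j) ((Scheme.Modules.pullback kX).obj G) g'.appTop.hom).ExactAt i :=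
  cechComplex_exactAt_of_isPullback_of_forall_exact_baseChange g U hUa G hL q
    (fun B' _ _ j hj => cechComplex_exact_baseChange_of_exactAt g U hcov hUa G hL q hex B' j hj) H i hi

end E2

/-! ### §3 (E1′) with ANY presentation of the fibre at each `k`-point -/

section AnyPresentation

variable {X B : Scheme.{0}} (g : X ⟶ B) [IsAffine B]
  {ι : Type} [LinearOrder ι] [Fintype ι] (U : ι → X.Opens)
  (hUa : ∀ s : Finset ι, s.Nonempty → IsAffineOpen (cechOpen U s)) (G : X.Modules) (hL : IsFiniteLocallyFree G)

include hUa hL in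
/-- **Two presentations of one fibre have simultaneously exact Čech complexes.** For a field-valued point `b : Spec K → B` of the affine base
and two cartesian squares `H₁ : IsPullback kX₁ g₁ g b`, `H₂ : IsPullback kX₂ g₂ g b`, the Čech complexes `Č•((kXₘ⁻¹ U_j)_j, kXₘ^* G)`
(scalars `gₘ♯`) are both `Č•(𝓤, G) ⊗_{Γ(B)} Γ(Spec K)` (★ `exists_extendScalars_cechComplex_iso_of_isPullback`), hence one is exact in degree
`i` iff the other is. [cite: GortzWedhorn2023, Prop. 22.90 (p. 277)] [cite: MumfordAV1970, §5 Cor. 3 (p. 53)] -/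
theorem cechComplex_exactAt_iff_of_isPullback_of_isPullback
    {K : Type} [Field K] {b : Spec (.of K) ⟶ B}
    {X₁ : Scheme.{0}} {kX₁ : X₁ ⟶ X} {g₁ : X₁ ⟶ Spec (.of K)} (H₁ : IsPullback kX₁ g₁ g b)
    {X₂ : Scheme.{0}} {kX₂ : X₂ ⟶ X} {g₂ : X₂ ⟶ Spec (.of K)} (H₂ : IsPullback kX₂ g₂ g b) (i : ℤ) :
    (cechComplex (fun j => kX₁ ⁻¹ᵁ U j) ((Scheme.Modules.pullback kX₁).obj G) g₁.appTop.hom).ExactAt i ↔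
      (cechComplex (fun j => kX₂ ⁻¹ᵁ U j) ((Scheme.Modules.pullback kX₂).obj G) g₂.appTop.hom).ExactAt i := by
  have hGa : IsAffineLocalizing G := by
    haveI := hL.isVectorBundle.1
    exact IsAffineLocalizing.of_isQuasicoherent G
  letI algb := (b.appLE ⊤ ⊤ le_top).hom.toAlgebra
  obtain ⟨Φ₁, -⟩ := exists_extendScalars_cechComplex_iso_of_isPullback H₁ U hUa G hGa
  obtain ⟨Φ₂, -⟩ := exists_extendScalars_cechComplex_iso_of_isPullback H₂ U hUa G hGa
  exact ⟨fun h => (h.of_iso Φ₁.symm).of_iso Φ₂, fun h => (h.of_iso Φ₂.symm).of_iso Φ₁⟩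

variable {k : Type} [Field k] [IsAlgClosed k] (f : B ⟶ Spec (.of k)) [LocallyOfFiniteType f] [IsProper g] [Flat g]
  (hcov : ⨆ i, U i = ⊤)

include hcov hUa hL in
/-- **(E1′), ANY PRESENTATION PER POINT ⇒ EXACT AFTER EVERY BASE CHANGE**: as ★ `cechComplex_exact_baseChange_of_forall_kPoint`, but the
fibre at each `k`-point `b` (`b ≫ f = 𝟙`) may be presented by ANY cartesian square `IsPullback kX g' g b` of the caller's choosing (e.g. a slice
map of a product): if for every such `b` SOME presentation has `Č•((kX⁻¹ U_j)_j, kX^* G)` exact in every degree `i ≥ q`, then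
`Č•(𝓤, G) ⊗_{Γ(B)} B'` is exact in every degree `i ≥ q` for every `Γ(B)`-algebra `B'`.
[cite: MumfordAV1970, §5 Cor. 3 (p. 53)] [cite: Hartshorne1977, III Thm. 12.11 (p. 290)] [cite: GortzWedhorn2023, Prop. 22.90 (p. 277)] -/
theorem cechComplex_exact_baseChange_of_forall_kPoint_isPullback (q : ℤ)
    (hfib : ∀ (b : Spec (.of k) ⟶ B), b ≫ f = 𝟙 _ →
      ∃ (X' : Scheme.{0}) (kX : X' ⟶ X) (g' : X' ⟶ Spec (.of k)) (_ : IsPullback kX g' g b), ∀ i, q ≤ i →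
        (cechComplex (fun j => kX ⁻¹ᵁ U j) ((Scheme.Modules.pullback kX).obj G) g'.appTop.hom).ExactAt i)
    (B' : Type) [CommRing B'] [Algebra Γ(B, ⊤) B'] (i : ℤ) (hi : q ≤ i) :
    Function.Exact (((cechComplex U G g.appTop.hom).d (i - 1) i).hom.baseChange B')
      (((cechComplex U G g.appTop.hom).d i (i + 1)).hom.baseChange B') := by
  refine cechComplex_exact_baseChange_of_forall_kPoint g f U hcov hUa G hL q (fun b hb j hj => ?_) B' i hi
  obtain ⟨X', kX, g', H, hH⟩ := hfib b hb
  exact (cechComplex_exactAt_iff_of_isPullback_of_isPullback g U hUa G hL H (IsPullback.of_hasPullback g b) j).1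
    (hH j hj)

include hcov hUa hL in
/-- **(E1′), ANY PRESENTATION PER POINT ⇒ `Č•(𝓤, G)` EXACT** in every degree `i ≥ q`.
[cite: MumfordAV1970, §5 Cor. 3 (p. 53); §8 Thm. 1 (p. 77)] -/
theorem cechComplex_exactAt_of_forall_kPoint_isPullback (q : ℤ)
    (hfib : ∀ (b : Spec (.of k) ⟶ B), b ≫ f = 𝟙 _ →
      ∃ (X' : Scheme.{0}) (kX : X' ⟶ X) (g' : X' ⟶ Spec (.of k)) (_ : IsPullback kX g' g b), ∀ i, q ≤ i →
        (cechComplex (fun j => kX ⁻¹ᵁ U j) ((Scheme.Modules.pullback kX).obj G) g'.appTop.hom).ExactAt i)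
    (i : ℤ) (hi : q ≤ i) : (cechComplex U G g.appTop.hom).ExactAt i := by
  rw [exactAt_iff_function_exact (cechComplex U G g.appTop.hom) (i - 1) i (i + 1) (by omega) rfl]
  exact (function_exact_baseChange_self_iff _ _).1
    (cechComplex_exact_baseChange_of_forall_kPoint_isPullback g U hUa G hL f hcov q hfib Γ(B, ⊤) i hi)

include hcov hUa hL in
/-- **(E1‴), ANY PRESENTATIONS ⇒ EVERY FIELD-VALUED FIBRE, ANY PRESENTATION**: fibrewise exact (degrees `≥ q`) at every `k`-point in some
presentation ⇒ exact in degrees `≥ q` at every field-valued point `b' : Spec K → B` in every presentation `IsPullback kX g' g b'` (in particular at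
generic points). [cite: MumfordAV1970, §5 Cor. 3 (p. 53)] [cite: Hartshorne1977, III Thm. 12.11 (p. 290)] -/
theorem cechComplex_exactAt_of_isPullback_of_forall_kPoint_isPullback (q : ℤ)
    (hfib : ∀ (b : Spec (.of k) ⟶ B), b ≫ f = 𝟙 _ →
      ∃ (X' : Scheme.{0}) (kX : X' ⟶ X) (g' : X' ⟶ Spec (.of k)) (_ : IsPullback kX g' g b), ∀ i, q ≤ i →
        (cechComplex (fun j => kX ⁻¹ᵁ U j) ((Scheme.Modules.pullback kX).obj G) g'.appTop.hom).ExactAt i)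
    {K : Type} [Field K] {b' : Spec (.of K) ⟶ B} {X' : Scheme.{0}} {kX : X' ⟶ X} {g' : X' ⟶ Spec (.of K)}
    (H : IsPullback kX g' g b') (i : ℤ) (hi : q ≤ i) :
    (cechComplex (fun j => kX ⁻¹ᵁ U j) ((Scheme.Modules.pullback kX).obj G) g'.appTop.hom).ExactAt i :=
  cechComplex_exactAt_of_isPullback_of_forall_exact_baseChange g U hUa G hL q
    (fun B'' _ _ j hj => cechComplex_exact_baseChange_of_forall_kPoint_isPullback g U hUa G hL f hcov q hfib B'' j hj) H i hi

end AnyPresentation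

end Literature.AlgebraicGeometry.Modules

end
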